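import Summits.Parity.GeneralizedHardyLittlewood.Theorems.PrimeLevelFamEdgeMomentsBeyondDiagonalLayersClassLengths
import Summits.Parity.GeneralizedHardyLittlewood.Theorems.PrimeLevelFamEdgeMomentsBeyondDiagonalLayersClassGeneric
import HarnessLib

/-!
# Route `PrimeLevelFamEdge`, crux K_A `MomentsBeyondDiagonal` (stmt-Parity-20007), line «petersson_layers» v4:
# Pascadi's bracket in the REVERSED ordering (`σ₁'Z₁Z₂ ≤ σ₂'V`) of a sharp class (assembly step E5b, inputs)

`…LayersClassLengths.bracket71_class_le` / `…LayersClassGeneric.bracket71_generic_le` treat the bracket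
`bracket71(σ₁'Z₁Z₂, σ₂'V; qr/g, r/g, r/g)` of `…LayersClassBoundAll.norm_classForm_le_of_pascadi_all` (ordering
`σ₂'V ≤ σ₁'Z₁Z₂`).  The twin `…norm_classForm_le_of_pascadi_all'` (ordering `σ₁'Z₁Z₂ ≤ σ₂'V`, which is the generic one when
`2(Δ'−1) < η`) carries `bracket71(σ₂'V, σ₁'Z₁Z₂; qr/g, r/g, r/g)`; Pascadi's bracket is NOT symmetric, so it needs its own
generic evaluation:
* `bracket71_class_le'`:
  `bracket71(σ₂'V, σ₁'Z₁Z₂; qr/g, r/g, r/g) ≤ r s₂² Y³ x^{2Δ'}/(g²(d₁d₂)⁴t₁²(qr)³) + r s₂² Y²/(g(d₁d₂)²t₁²(qr)²) + g/r`;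
* `generic_scalar_oneB_le` (`x^{2Δ'}·Y³·r/(qr)³ ≤ x^{−13/100}`), `generic_scalar_twoB_le` (`Y²·r/(qr)² ≤ x^{−13/100}`);
* **`bracket71_generic_le'`**: the three terms are `≤ 3·s₂²·g·x^{−13/100}` on the band (`q ≥ 64`, `Δ' ≤ 101/100`,
  `0 ≤ η ≤ 1/100`, `Y = ⌈x^{2+η}⌉`, `x^{11/10} < r`; exponent checks `2.02 + 6.03 ≤ −0.13 + 6 + 2.2`, `4.02 ≤ −0.13 + 4 + 1.1`).
After the sixth root the class weight `s₂^{1/3}g^{1/6}` is absorbed by the `ℓ²` sizes exactly as `t₁^{1/3}g^{1/6}` is in the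
other ordering (census of this generation).  Proof only (def-free helper); K_A NOT proved; nothing about Landau–Siegel zeros.
-/

noncomputable section

open scoped Real Nat
open Complex Finset Polynomial MeasureTheory
open Literature.NumberTheory.LFunctions

namespace Summit.Parity.GeneralizedHardyLittlewood.Theorems.MomentsBeyondDiagonal.Layers

open Summit.Parity.GeneralizedHardyLittlewood.Theorems.PrimeLevelFamEdgeIdeaDeltas.PeterssonLayers

/-- **Pascadi's bracket on a class in generic variables, reversed ordering** (`x = q̂ > 0`; `g ∣ s₁t₁`, `g ∣ s₂t₂`,
`g ∣ r`; all of `q, r, dᵢ, sᵢ, tᵢ, g ≥ 1`):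
`bracket71(σ₂'V, σ₁'Z₁Z₂; qr/g, r/g, r/g) ≤ r s₂² Y³ x^{2Δ'}/(g²(d₁d₂)⁴t₁²(qr)³) + r s₂² Y²/(g(d₁d₂)²t₁²(qr)²) + g/r`.
[cite: Pascadi2025, Thm. 7.1 (right-hand side)] -/
theorem bracket71_class_le' {x Δ' : ℝ} (hx : 0 < x) {q r Y d₁ d₂ s₁ s₂ t₁ t₂ g : ℕ} (hq : 1 ≤ q) (hr : 1 ≤ r)
    (hd₁ : 1 ≤ d₁) (hd₂ : 1 ≤ d₂) (hs₁ : 1 ≤ s₁) (hs₂ : 1 ≤ s₂) (ht₁ : 1 ≤ t₁) (ht₂ : 1 ≤ t₂) (hg0 : 1 ≤ g)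
    (hg₁ : g ∣ s₁ * t₁) (hg₂ : g ∣ s₂ * t₂) (hgr : g ∣ r) :
    Pascadi2025.bracket71
        ((s₂ * t₂ / g * (Y / (d₁ * t₁ * (d₂ * t₂))) : ℕ) : ℝ)
        ((s₁ * t₁ / g * ((⌊x ^ Δ'⌋₊ / d₁ / s₁) * (⌊x ^ Δ'⌋₊ / d₂ / s₂)) : ℕ) : ℝ)
        ((q * r / g : ℕ) : ℝ) ((r / g : ℕ) : ℝ) ((r / g : ℕ) : ℝ) ≤
      (r : ℝ) * (s₂ : ℝ) ^ 2 * (Y : ℝ) ^ 3 * x ^ (2 * Δ') /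
          ((g : ℝ) ^ 2 * ((d₁ : ℝ) * d₂) ^ 4 * (t₁ : ℝ) ^ 2 * ((q : ℝ) * r) ^ 3) +
        (r : ℝ) * (s₂ : ℝ) ^ 2 * (Y : ℝ) ^ 2 / ((g : ℝ) * ((d₁ : ℝ) * d₂) ^ 2 * (t₁ : ℝ) ^ 2 * ((q : ℝ) * r) ^ 2) +
        (g : ℝ) / r := by
  have hg0' : (g : ℝ) ≠ 0 := by exact_mod_cast (by omega : g ≠ 0)
  have hgpos : (0 : ℝ) < g := by exact_mod_cast hg0
  have hqr : g ∣ q * r := hgr.mul_left q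
  have hc : ((q * r / g : ℕ) : ℝ) = (q : ℝ) * r / g := by rw [Nat.cast_div hqr hg0']; push_cast; ring
  have hr' : ((r / g : ℕ) : ℝ) = (r : ℝ) / g := by rw [Nat.cast_div hgr hg0']
  have hM := cast_dilatedMollifier_le (x := x) (Δ' := Δ') hx hd₁ hd₂ hs₁ hs₂ hg0 hg₁
  have hN := cast_dilatedAFE_le (Y := Y) hd₁ hd₂ ht₁ ht₂ hg0 hg₂
  rw [hc, hr']
  refine (bracket71_mono (Nat.cast_nonneg _) hN (Nat.cast_nonneg _) hM (by positivity) (by positivity)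
    (by positivity)).trans (le_of_eq ?_)
  unfold Pascadi2025.bracket71
  have hq0 : (q : ℝ) ≠ 0 := by exact_mod_cast (by omega : q ≠ 0)
  have hr0 : (r : ℝ) ≠ 0 := by exact_mod_cast (by omega : r ≠ 0)
  have hd₁0 : (d₁ : ℝ) ≠ 0 := by exact_mod_cast (by omega : d₁ ≠ 0)
  have hd₂0 : (d₂ : ℝ) ≠ 0 := by exact_mod_cast (by omega : d₂ ≠ 0)
  have hs₂0 : (s₂ : ℝ) ≠ 0 := by exact_mod_cast (by omega : s₂ ≠ 0)
  have ht₁0 : (t₁ : ℝ) ≠ 0 := by exact_mod_cast (by omega : t₁ ≠ 0)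
  field_simp

/-- `x^{2Δ'}·Y³·r ≤ x^{−13/100}·(qr)³` on the band (`Y = ⌈x^{2+η}⌉`), i.e. `x^{2Δ'}·Y³·r/(qr)³ ≤ x^{−13/100}`. [folklore] -/
theorem generic_scalar_oneB_le {q : ℕ} [NeZero q] (h64 : 64 ≤ q) {Δ' η : ℝ} (hΔ' : Δ' ≤ 101 / 100)
    (hη0 : 0 ≤ η) (hη : η ≤ 1 / 100) {r : ℕ} (hr : KMV2000.qhat q ^ (11 / 10 : ℝ) < r) :
    KMV2000.qhat q ^ (2 * Δ') * ((⌈KMV2000.qhat q ^ (2 + η)⌉₊ : ℕ) : ℝ) ^ 3 * r / ((q : ℝ) * r) ^ 3 ≤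
      KMV2000.qhat q ^ (-(13 / 100 : ℝ)) := by
  have hqh1 : 1 < KMV2000.qhat q := one_lt_qhat h64
  have hqh0 : 0 < KMV2000.qhat q := zero_lt_one.trans hqh1
  set x : ℝ := KMV2000.qhat q with hx
  have hr0 : (0 : ℝ) < r := lt_trans (Real.rpow_pos_of_pos hqh0 _) hr
  have hq : (q : ℝ) = 4 * π ^ 2 * x ^ 2 := by rw [hx]; exact natCast_eq_four_pi_sq_mul_qhat_sq q
  have hq0 : (0 : ℝ) < q := by rw [hq]; positivity
  have hY : ((⌈x ^ (2 + η)⌉₊ : ℕ) : ℝ) ≤ 2 * x ^ (201 / 100 : ℝ) :=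
    (natCeil_le_two_mul (Real.one_le_rpow hqh1.le (by linarith))).trans
      (mul_le_mul_of_nonneg_left (Real.rpow_le_rpow_of_exponent_le hqh1.le (by linarith)) (by norm_num))
  have hY3 : (((⌈x ^ (2 + η)⌉₊ : ℕ) : ℝ)) ^ 3 ≤ 8 * x ^ (603 / 100 : ℝ) := by
    calc (((⌈x ^ (2 + η)⌉₊ : ℕ) : ℝ)) ^ 3 ≤ (2 * x ^ (201 / 100 : ℝ)) ^ 3 := pow_le_pow_left₀ (Nat.cast_nonneg _) hY 3
      _ = 8 * (x ^ (201 / 100 : ℝ)) ^ (3 : ℕ) := by ring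
      _ = 8 * x ^ (603 / 100 : ℝ) := by
          rw [← Real.rpow_natCast (x ^ (201 / 100 : ℝ)) 3, ← Real.rpow_mul hqh0.le]; norm_num
  have hx2 : x ^ (2 * Δ') ≤ x ^ (202 / 100 : ℝ) := Real.rpow_le_rpow_of_exponent_le hqh1.le (by linarith)
  rw [div_le_iff₀ (by positivity)]
  -- upper bound for the left side: `8 x^{805/100} r`
  have hL : x ^ (2 * Δ') * (((⌈x ^ (2 + η)⌉₊ : ℕ) : ℝ)) ^ 3 * r ≤ 8 * x ^ (805 / 100 : ℝ) * r := by
    calc x ^ (2 * Δ') * (((⌈x ^ (2 + η)⌉₊ : ℕ) : ℝ)) ^ 3 * r ≤ x ^ (202 / 100 : ℝ) * (8 * x ^ (603 / 100 : ℝ)) * r :=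
          mul_le_mul_of_nonneg_right (mul_le_mul hx2 hY3 (by positivity) (Real.rpow_nonneg hqh0.le _)) hr0.le
      _ = 8 * x ^ (805 / 100 : ℝ) * r := by
          rw [show (805 / 100 : ℝ) = 202 / 100 + 603 / 100 by norm_num, Real.rpow_add hqh0]; ring
  -- lower bound for the right side: `(4π²)³ x^{807/100} r`
  have hr2 : x ^ (11 / 5 : ℝ) ≤ (r : ℝ) ^ 2 := by
    have h := pow_le_pow_left₀ (Real.rpow_nonneg hqh0.le _) hr.le 2
    rw [← Real.rpow_natCast, ← Real.rpow_mul hqh0.le] at h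
    norm_num at h
    exact h
  have hR : (4 * π ^ 2) ^ 3 * x ^ (807 / 100 : ℝ) * r ≤ x ^ (-(13 / 100 : ℝ)) * ((q : ℝ) * r) ^ 3 := by
    have e : x ^ (-(13 / 100 : ℝ)) * ((q : ℝ) * r) ^ 3 =
        (4 * π ^ 2) ^ 3 * (x ^ (-(13 / 100 : ℝ)) * x ^ (6 : ℝ)) * ((r : ℝ) ^ 2 * r) := by
      rw [hq, show (6 : ℝ) = ((6 : ℕ) : ℝ) by norm_num, Real.rpow_natCast]; ring
    rw [e]
    have e2 : (4 * π ^ 2) ^ 3 * x ^ (807 / 100 : ℝ) * r =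
        (4 * π ^ 2) ^ 3 * (x ^ (-(13 / 100 : ℝ)) * x ^ (6 : ℝ)) * (x ^ (11 / 5 : ℝ) * r) := by
      rw [show (4 * π ^ 2) ^ 3 * (x ^ (-(13 / 100 : ℝ)) * x ^ (6 : ℝ)) * (x ^ (11 / 5 : ℝ) * r) =
          (4 * π ^ 2) ^ 3 * (x ^ (-(13 / 100 : ℝ)) * x ^ (6 : ℝ) * x ^ (11 / 5 : ℝ)) * r by ring,
        ← Real.rpow_add hqh0, ← Real.rpow_add hqh0]
      norm_num
    rw [e2]
    exact mul_le_mul_of_nonneg_left (mul_le_mul_of_nonneg_right hr2 hr0.le) (by positivity)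
  have hπ : (8 : ℝ) ≤ (4 * π ^ 2) ^ 3 := by
    have h2 : (2 : ℝ) ≤ 4 * π ^ 2 := by nlinarith [Real.pi_gt_three]
    calc (8 : ℝ) = 2 ^ 3 := by norm_num
      _ ≤ (4 * π ^ 2) ^ 3 := pow_le_pow_left₀ (by norm_num) h2 3
  have hx805 : x ^ (805 / 100 : ℝ) ≤ x ^ (807 / 100 : ℝ) := Real.rpow_le_rpow_of_exponent_le hqh1.le (by norm_num)
  calc x ^ (2 * Δ') * (((⌈x ^ (2 + η)⌉₊ : ℕ) : ℝ)) ^ 3 * r ≤ 8 * x ^ (805 / 100 : ℝ) * r := hL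
    _ ≤ (4 * π ^ 2) ^ 3 * x ^ (807 / 100 : ℝ) * r :=
        mul_le_mul_of_nonneg_right (mul_le_mul hπ hx805 (Real.rpow_nonneg hqh0.le _) (by positivity)) hr0.le
    _ ≤ _ := hR

/-- `Y²·r/(qr)² ≤ x^{−13/100}` on the band (`Y = ⌈x^{2+η}⌉`). [folklore] -/
theorem generic_scalar_twoB_le {q : ℕ} [NeZero q] (h64 : 64 ≤ q) {η : ℝ} (hη0 : 0 ≤ η) (hη : η ≤ 1 / 100)
    {r : ℕ} (hr : KMV2000.qhat q ^ (11 / 10 : ℝ) < r) :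
    ((⌈KMV2000.qhat q ^ (2 + η)⌉₊ : ℕ) : ℝ) ^ 2 * r / ((q : ℝ) * r) ^ 2 ≤ KMV2000.qhat q ^ (-(13 / 100 : ℝ)) := by
  have hqh1 : 1 < KMV2000.qhat q := one_lt_qhat h64
  have hqh0 : 0 < KMV2000.qhat q := zero_lt_one.trans hqh1
  set x : ℝ := KMV2000.qhat q with hx
  have hr0 : (0 : ℝ) < r := lt_trans (Real.rpow_pos_of_pos hqh0 _) hr
  have hq : (q : ℝ) = 4 * π ^ 2 * x ^ 2 := by rw [hx]; exact natCast_eq_four_pi_sq_mul_qhat_sq q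
  have hq0 : (0 : ℝ) < q := by rw [hq]; positivity
  have hY : ((⌈x ^ (2 + η)⌉₊ : ℕ) : ℝ) ≤ 2 * x ^ (201 / 100 : ℝ) :=
    (natCeil_le_two_mul (Real.one_le_rpow hqh1.le (by linarith))).trans
      (mul_le_mul_of_nonneg_left (Real.rpow_le_rpow_of_exponent_le hqh1.le (by linarith)) (by norm_num))
  have hY2 : (((⌈x ^ (2 + η)⌉₊ : ℕ) : ℝ)) ^ 2 ≤ 4 * x ^ (402 / 100 : ℝ) := by
    calc (((⌈x ^ (2 + η)⌉₊ : ℕ) : ℝ)) ^ 2 ≤ (2 * x ^ (201 / 100 : ℝ)) ^ 2 := pow_le_pow_left₀ (Nat.cast_nonneg _) hY 2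
      _ = 4 * (x ^ (201 / 100 : ℝ)) ^ (2 : ℕ) := by ring
      _ = 4 * x ^ (402 / 100 : ℝ) := by
          rw [← Real.rpow_natCast (x ^ (201 / 100 : ℝ)) 2, ← Real.rpow_mul hqh0.le]; norm_num
  rw [div_le_iff₀ (by positivity)]
  have e : x ^ (-(13 / 100 : ℝ)) * ((q : ℝ) * r) ^ 2 =
      (4 * π ^ 2) ^ 2 * (x ^ (-(13 / 100 : ℝ)) * x ^ (4 : ℝ)) * ((r : ℝ) * r) := by
    rw [hq, show (4 : ℝ) = ((4 : ℕ) : ℝ) by norm_num, Real.rpow_natCast]; ring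
  rw [e]
  have hπ : (4 : ℝ) ≤ (4 * π ^ 2) ^ 2 := by
    have h1 : (2 : ℝ) ≤ 4 * π ^ 2 := by nlinarith [Real.pi_gt_three]
    nlinarith
  have hx402 : x ^ (402 / 100 : ℝ) ≤ x ^ (497 / 100 : ℝ) := Real.rpow_le_rpow_of_exponent_le hqh1.le (by norm_num)
  have hmono : x ^ (497 / 100 : ℝ) * (r : ℝ) ≤ (x ^ (-(13 / 100 : ℝ)) * x ^ (4 : ℝ)) * ((r : ℝ) * r) := by
    have e2 : x ^ (497 / 100 : ℝ) = (x ^ (-(13 / 100 : ℝ)) * x ^ (4 : ℝ)) * x ^ (11 / 10 : ℝ) := by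
      rw [← Real.rpow_add hqh0, ← Real.rpow_add hqh0]; norm_num
    rw [e2, mul_assoc]
    exact mul_le_mul_of_nonneg_left (mul_le_mul_of_nonneg_right hr.le hr0.le) (by positivity)
  calc (((⌈x ^ (2 + η)⌉₊ : ℕ) : ℝ)) ^ 2 * r ≤ 4 * x ^ (402 / 100 : ℝ) * r := mul_le_mul_of_nonneg_right hY2 hr0.le
    _ ≤ 4 * x ^ (497 / 100 : ℝ) * r :=
        mul_le_mul_of_nonneg_right (mul_le_mul_of_nonneg_left hx402 (by norm_num)) hr0.le
    _ = 4 * (x ^ (497 / 100 : ℝ) * r) := by ring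
    _ ≤ 4 * ((x ^ (-(13 / 100 : ℝ)) * x ^ (4 : ℝ)) * ((r : ℝ) * r)) := mul_le_mul_of_nonneg_left hmono (by norm_num)
    _ ≤ (4 * π ^ 2) ^ 2 * ((x ^ (-(13 / 100 : ℝ)) * x ^ (4 : ℝ)) * ((r : ℝ) * r)) :=
        mul_le_mul_of_nonneg_right hπ (by positivity)
    _ = _ := by ring

/-- **The generic size of the reversed class bracket**: for class data `g, d₁, d₂, s₂, t₁ ≥ 1` on the band,
`r s₂² Y³ x^{2Δ'}/(g²(d₁d₂)⁴t₁²(qr)³) + r s₂² Y²/(g(d₁d₂)²t₁²(qr)²) + g/r ≤ 3·s₂²·g·x^{−13/100}` (`Y = ⌈x^{2+η}⌉`). [folklore] -/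
theorem bracket71_generic_le' {q : ℕ} [NeZero q] (h64 : 64 ≤ q) {Δ' η : ℝ} (hΔ' : Δ' ≤ 101 / 100)
    (hη0 : 0 ≤ η) (hη : η ≤ 1 / 100) {r : ℕ} (hr : KMV2000.qhat q ^ (11 / 10 : ℝ) < r)
    {g d₁ d₂ s₂ t₁ : ℕ} (hg : 1 ≤ g) (hd₁ : 1 ≤ d₁) (hd₂ : 1 ≤ d₂) (hs₂ : 1 ≤ s₂) (ht₁ : 1 ≤ t₁) :
    (r : ℝ) * (s₂ : ℝ) ^ 2 * (((⌈KMV2000.qhat q ^ (2 + η)⌉₊ : ℕ) : ℝ)) ^ 3 * KMV2000.qhat q ^ (2 * Δ') /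
          ((g : ℝ) ^ 2 * ((d₁ : ℝ) * d₂) ^ 4 * (t₁ : ℝ) ^ 2 * ((q : ℝ) * r) ^ 3) +
        (r : ℝ) * (s₂ : ℝ) ^ 2 * (((⌈KMV2000.qhat q ^ (2 + η)⌉₊ : ℕ) : ℝ)) ^ 2 /
          ((g : ℝ) * ((d₁ : ℝ) * d₂) ^ 2 * (t₁ : ℝ) ^ 2 * ((q : ℝ) * r) ^ 2) +
        (g : ℝ) / r ≤
      3 * (s₂ : ℝ) ^ 2 * g * KMV2000.qhat q ^ (-(13 / 100 : ℝ)) := by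
  have hqh1 : 1 < KMV2000.qhat q := one_lt_qhat h64
  have hqh0 : 0 < KMV2000.qhat q := zero_lt_one.trans hqh1
  set x : ℝ := KMV2000.qhat q with hx
  have hr0 : (0 : ℝ) < r := lt_trans (Real.rpow_pos_of_pos hqh0 _) hr
  have hq : (q : ℝ) = 4 * π ^ 2 * x ^ 2 := by rw [hx]; exact natCast_eq_four_pi_sq_mul_qhat_sq q
  have hq0 : (0 : ℝ) < q := by rw [hq]; positivity
  have hqr : (0 : ℝ) < (q : ℝ) * r := by positivity
  have h1 := generic_scalar_oneB_le h64 hΔ' hη0 hη hr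
  have h2 := generic_scalar_twoB_le h64 hη0 hη hr
  have h3 := generic_scalar_three_le h64 hr
  have hg1 : (1 : ℝ) ≤ g := by exact_mod_cast hg
  have hs1 : (1 : ℝ) ≤ s₂ := by exact_mod_cast hs₂
  have hD1 : (1 : ℝ) ≤ (g : ℝ) ^ 2 * ((d₁ : ℝ) * d₂) ^ 4 * (t₁ : ℝ) ^ 2 := by
    have : (1 : ℝ) ≤ d₁ := by exact_mod_cast hd₁
    have : (1 : ℝ) ≤ d₂ := by exact_mod_cast hd₂
    have : (1 : ℝ) ≤ t₁ := by exact_mod_cast ht₁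
    have hdd : (1 : ℝ) ≤ (d₁ : ℝ) * d₂ := by nlinarith
    calc (1 : ℝ) = 1 ^ 2 * 1 ^ 4 * 1 ^ 2 := by norm_num
      _ ≤ (g : ℝ) ^ 2 * ((d₁ : ℝ) * d₂) ^ 4 * (t₁ : ℝ) ^ 2 := by gcongr
  have hD2 : (1 : ℝ) ≤ (g : ℝ) * ((d₁ : ℝ) * d₂) ^ 2 * (t₁ : ℝ) ^ 2 := by
    have : (1 : ℝ) ≤ d₁ := by exact_mod_cast hd₁
    have : (1 : ℝ) ≤ d₂ := by exact_mod_cast hd₂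
    have : (1 : ℝ) ≤ t₁ := by exact_mod_cast ht₁
    have hdd : (1 : ℝ) ≤ (d₁ : ℝ) * d₂ := by nlinarith
    calc (1 : ℝ) = 1 * 1 ^ 2 * 1 ^ 2 := by norm_num
      _ ≤ (g : ℝ) * ((d₁ : ℝ) * d₂) ^ 2 * (t₁ : ℝ) ^ 2 := by gcongr
  set E : ℝ := x ^ (-(13 / 100 : ℝ)) with hE
  have hE0 : 0 < E := Real.rpow_pos_of_pos hqh0 _
  set Yr : ℝ := ((⌈x ^ (2 + η)⌉₊ : ℕ) : ℝ) with hYr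
  -- term 1
  have hT1 : (r : ℝ) * (s₂ : ℝ) ^ 2 * Yr ^ 3 * x ^ (2 * Δ') /
      ((g : ℝ) ^ 2 * ((d₁ : ℝ) * d₂) ^ 4 * (t₁ : ℝ) ^ 2 * ((q : ℝ) * r) ^ 3) ≤ (s₂ : ℝ) ^ 2 * g * E := by
    calc _ ≤ (r : ℝ) * (s₂ : ℝ) ^ 2 * Yr ^ 3 * x ^ (2 * Δ') / (1 * ((q : ℝ) * r) ^ 3) := by
          refine div_le_div_of_nonneg_left (by positivity) (by positivity) ?_
          exact mul_le_mul_of_nonneg_right hD1 (by positivity)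
      _ = (s₂ : ℝ) ^ 2 * (x ^ (2 * Δ') * Yr ^ 3 * r / ((q : ℝ) * r) ^ 3) := by ring
      _ ≤ (s₂ : ℝ) ^ 2 * E := mul_le_mul_of_nonneg_left h1 (by positivity)
      _ = (s₂ : ℝ) ^ 2 * 1 * E := by ring
      _ ≤ (s₂ : ℝ) ^ 2 * g * E := by gcongr
  -- term 2
  have hT2 : (r : ℝ) * (s₂ : ℝ) ^ 2 * Yr ^ 2 / ((g : ℝ) * ((d₁ : ℝ) * d₂) ^ 2 * (t₁ : ℝ) ^ 2 * ((q : ℝ) * r) ^ 2) ≤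
      (s₂ : ℝ) ^ 2 * g * E := by
    calc _ ≤ (r : ℝ) * (s₂ : ℝ) ^ 2 * Yr ^ 2 / (1 * ((q : ℝ) * r) ^ 2) := by
          refine div_le_div_of_nonneg_left (by positivity) (by positivity) ?_
          exact mul_le_mul_of_nonneg_right hD2 (by positivity)
      _ = (s₂ : ℝ) ^ 2 * (Yr ^ 2 * r / ((q : ℝ) * r) ^ 2) := by ring
      _ ≤ (s₂ : ℝ) ^ 2 * E := mul_le_mul_of_nonneg_left h2 (by positivity)
      _ = (s₂ : ℝ) ^ 2 * 1 * E := by ring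
      _ ≤ (s₂ : ℝ) ^ 2 * g * E := by gcongr
  -- term 3
  have hT3 : (g : ℝ) / r ≤ (s₂ : ℝ) ^ 2 * g * E := by
    calc (g : ℝ) / r = g * (1 / (r : ℝ)) := by ring
      _ ≤ g * E := mul_le_mul_of_nonneg_left h3 (by positivity)
      _ = 1 ^ 2 * g * E := by ring
      _ ≤ (s₂ : ℝ) ^ 2 * g * E := by gcongr
  linarith

end Summit.Parity.GeneralizedHardyLittlewood.Theorems.MomentsBeyondDiagonal.Layers

end
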